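import Summits.BirchSwinnertonDyer.BirchSwinnertonDyer.Theorems.PrintCFramBottomClassIndexLawFiveLeCohenCutIntegrality
import HarnessLib

/-!
# Crux `PrintCFram.BottomClassIndexLawFiveLe` (stmt-BirchSwinnertonDyer-20372), line `eisenstein-resource-bdp-line` (registry v23/v24):
# THE COHEN DICTIONARY ON THE `m`-CUT, part 4 — THE `p`-INTEGRAL CUT SERIES `Y = Σ_{a ∈ CUT(m,r,e)} H(k,a) qᵃ ∈ ℤ_p⟦q⟧` and, for
# `G := −Y.map ι`, the SUPPORT and DICTIONARY conjuncts of `stub_cutForm` in their verbatim shape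
# (cell `bsd-print-cfram`, width seat `bsd-line-cfram-p1-w4` g12; THEOREMS ONLY, `--supports` 20372; BSD is not proved by any of this)

HONEST FRAMING. Nothing here is a statement about BSD or about any curve; no registered stub is closed. Registry v23/v24's
`stub_cutForm` (= (CutForm⁶)) asks, per class datum and auxiliary `(r, e)`, for `𝔽, ι, M, w, Θ, G, T` with: the five Katz axioms,
`G·T ∈ M (k + (p+1)/2)`, `T ≠ 0` `p`-supported, **`supp G ⊆ CUT(m, r, e)`** and **the Cohen dictionary on the cut**. Parts 1–3
(`…CohenCutKronecker/Dictionary/Integrality`) proved the dictionary identity and the `p`-integrality of `H(k, a)` on the cut. This file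
packages them into the CANONICAL candidate for `G`: the `ℤ_p`-integral cut series
`Y := Σ_{a ∈ CUT(m,r,e)} y_a qᵃ`, `↑y_a = H(k, a)` (`exists_cutSeries`), and for every field `𝔽` and ring map `ι : ℤ_[p] →+* 𝔽` the
series `G := −(Y.map ι)` satisfies the SUPPORT conjunct and the DICTIONARY conjunct of `stub_cutForm` VERBATIM
(`cutForm_support_and_dictionary`). What the glue (LEAD g13 (G4)) still has to supply for THIS `G` is only the modular-forms part:
a Katz family containing `G·T` in weight `k + (p+1)/2` (NF-A × NF-B cut by NF-C, reduced by NF-D). beyond-print theorem: NO.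

References: [Cohen1975] §2, Thm. 3.1; crux notes `Lines/eisenstein-resource-bdp-line-w8g6-notes.md` §3, `…-w4g12-notes.md` §2.
-/

set_option autoImplicit false
-- summit-side namespace `Summit.BirchSwinnertonDyer.BirchSwinnertonDyer.…` (single-conjunct summit, D-0017 layout)
set_option linter.dupNamespace false

noncomputable section

open scoped Classical NumberTheorySymbols
open NumberField DirichletCharacter PowerSeries
open Literature.NumberTheory.LFunctions Literature.NumberTheory.ModularForms.CohenEisenstein Literature.NumberTheory.EllipticCurves
  Literature.NumberTheory.EllipticCurves.KrizLi2019

namespace Summit.BirchSwinnertonDyer.BirchSwinnertonDyer.Theorems.PrintCFram.CohenCut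

open Summit.BirchSwinnertonDyer.BirchSwinnertonDyer.Theorems.PrintCFram

variable {p : ℕ} [hp : Fact p.Prime]

/-! ## §1 The `ℤ_p`-integral cut series -/

/-- **The `p`-integral `(r,e)`-refined `m`-cut of the Cohen series EXISTS in `ℤ_p⟦q⟧`**: a power series `Y` over `ℤ_[p]` with
`↑(coeff a Y) = H(k, a)` at every `a ∈ CUT(m, r, e)` (`m ∣ a`, `a/m ≡ 3 (4)`, the Jacobi clauses, the `2 ∣ m` clause, `r^e ∥ a/m`) and
`coeff a Y = 0` off the cut — by `exists_padicInt_eq_cohenH_of_cut` coefficientwise. Class data as in parts 2–3.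
[cite: Cohen1975, §2 (definition of H(r, N))] -/
theorem exists_cutSeries {m : ℕ} [NeZero m] {χ : DirichletCharacter ℚ_[p] m} {k : ℕ}
    (hp4 : p % 4 = 3) (h7 : 7 ≤ p) (hmp : m.Coprime p) (hχ : χ.IsPrimitive) (hχq : χ.IsQuadratic)
    (hk : k = (p + 1) / 4 ∨ k = (3 * p - 1) / 4) (hpar : χ (-1) * (-1) ^ k = -1) (r e : ℕ) :
    ∃ Y : PowerSeries ℤ_[p],
      (∀ a : ℕ, (m ∣ a ∧ a / m % 4 = 3 ∧ (∀ q : ℕ, q.Prime → q ∣ m → q ≠ 2 → jacobiSym (-((a / m : ℕ) : ℤ)) q = 1) ∧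
          (2 ∣ m → a / m % 8 = 7) ∧ r ^ e ∣ a / m ∧ ¬ r ^ (e + 1) ∣ a / m) →
        ((coeff a Y : ℤ_[p]) : ℚ_[p]) = ((cohenH k a : ℚ) : ℚ_[p])) ∧
      (∀ a : ℕ, ¬ (m ∣ a ∧ a / m % 4 = 3 ∧ (∀ q : ℕ, q.Prime → q ∣ m → q ≠ 2 → jacobiSym (-((a / m : ℕ) : ℤ)) q = 1) ∧
          (2 ∣ m → a / m % 8 = 7) ∧ r ^ e ∣ a / m ∧ ¬ r ^ (e + 1) ∣ a / m) → coeff a Y = 0) := by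
  -- the coefficient function: the `ℤ_p`-lift of `H(k, a)` on the cut, `0` off it
  have key : ∀ a : ℕ, ∃ y : ℤ_[p],
      ((m ∣ a ∧ a / m % 4 = 3 ∧ (∀ q : ℕ, q.Prime → q ∣ m → q ≠ 2 → jacobiSym (-((a / m : ℕ) : ℤ)) q = 1) ∧
          (2 ∣ m → a / m % 8 = 7) ∧ r ^ e ∣ a / m ∧ ¬ r ^ (e + 1) ∣ a / m) → (y : ℚ_[p]) = ((cohenH k a : ℚ) : ℚ_[p])) ∧
      (¬ (m ∣ a ∧ a / m % 4 = 3 ∧ (∀ q : ℕ, q.Prime → q ∣ m → q ≠ 2 → jacobiSym (-((a / m : ℕ) : ℤ)) q = 1) ∧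
          (2 ∣ m → a / m % 8 = 7) ∧ r ^ e ∣ a / m ∧ ¬ r ^ (e + 1) ∣ a / m) → y = 0) := by
    intro a
    by_cases h : m ∣ a ∧ a / m % 4 = 3 ∧ (∀ q : ℕ, q.Prime → q ∣ m → q ≠ 2 → jacobiSym (-((a / m : ℕ) : ℤ)) q = 1) ∧
        (2 ∣ m → a / m % 8 = 7) ∧ r ^ e ∣ a / m ∧ ¬ r ^ (e + 1) ∣ a / m
    · obtain ⟨y, hy⟩ := exists_padicInt_eq_cohenH_of_cut hp4 h7 hmp hχ hχq hk hpar h.1 h.2.1 h.2.2.1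
      exact ⟨y, fun _ => hy, fun hn => absurd h hn⟩
    · exact ⟨0, fun hc => absurd hc h, fun _ => rfl⟩
  choose y hy using key
  exact ⟨PowerSeries.mk y, fun a ha => by rw [coeff_mk]; exact (hy a).1 ha, fun a ha => by rw [coeff_mk]; exact (hy a).2 ha⟩

/-! ## §2 The dictionary clause from lifts on the `(r,e)`-refined cut only -/

/-- **The dictionary clause of `stub_cutForm`, VERBATIM, from lifts on the `(r,e)`-REFINED cut** (variant of part 3's
`cutForm_dictionary_of_coeff` whose hypothesis asks for the lift `y_a` — `↑y_a = H(k, a)`, `coeff a G = ι(−y_a)` — only at the indices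
of the full six-clause cut `CUT(m, r, e)`, which is all the clause ever evaluates). [cite: Cohen1975, §2 (definition of H(r, N))] -/
theorem cutForm_dictionary_of_coeff_cut {m : ℕ} [NeZero m] {χ : DirichletCharacter ℚ_[p] m} {k : ℕ}
    (hp4 : p % 4 = 3) (h7 : 7 ≤ p) (hmp : m.Coprime p) (hχ : χ.IsPrimitive) (hχq : χ.IsQuadratic)
    (hk : k = (p + 1) / 4 ∨ k = (3 * p - 1) / 4) (hpar : χ (-1) * (-1) ^ k = -1)
    {𝔽 : Type} [Field 𝔽] (ι : ℤ_[p] →+* 𝔽) (G : PowerSeries 𝔽) {r e : ℕ}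
    (hG : ∀ a : ℕ, (m ∣ a ∧ a / m % 4 = 3 ∧ (∀ q : ℕ, q.Prime → q ∣ m → q ≠ 2 → jacobiSym (-((a / m : ℕ) : ℤ)) q = 1) ∧
        (2 ∣ m → a / m % 8 = 7) ∧ r ^ e ∣ a / m ∧ ¬ r ^ (e + 1) ∣ a / m) →
      ∃ y : ℤ_[p], (y : ℚ_[p]) = ((cohenH k a : ℚ) : ℚ_[p]) ∧ PowerSeries.coeff a G = ι (-y)) :
    ∀ (n₀ f : ℕ) (K : Type) [Field K] [NumberField K] (εK : DirichletCharacter ℚ_[p] (NumberField.discr K).natAbs),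
      Squarefree n₀ → n₀ % 4 = 3 → 0 < f →
      (m ∣ m * (n₀ * f ^ 2) ∧ m * (n₀ * f ^ 2) / m % 4 = 3 ∧
        (∀ q : ℕ, q.Prime → q ∣ m → q ≠ 2 → jacobiSym (-((m * (n₀ * f ^ 2) / m : ℕ) : ℤ)) q = 1) ∧
        (2 ∣ m → m * (n₀ * f ^ 2) / m % 8 = 7) ∧ r ^ e ∣ m * (n₀ * f ^ 2) / m ∧
        ¬ r ^ (e + 1) ∣ m * (n₀ * f ^ 2) / m) →
      IsImaginaryQuadratic K → NumberField.discr K = -(n₀ : ℤ) → IsKroneckerCharacterOf K εK →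
      ∃ (t : ℤ) (x : ℤ_[p]), (f = 1 → t = 1) ∧
        (x : ℚ_[p]) = (k : ℚ_[p])⁻¹ * @generalizedBernoulli ℚ_[p] _ _
          (changeLevel (dvd_mul_right m (NumberField.discr K).natAbs) χ *
            changeLevel (dvd_mul_left (NumberField.discr K).natAbs m) εK).conductor ⟨conductor_ne_zero _⟩ k
          (changeLevel (dvd_mul_right m (NumberField.discr K).natAbs) χ *
            changeLevel (dvd_mul_left (NumberField.discr K).natAbs m) εK).primitiveCharacter ∧
        PowerSeries.coeff (m * (n₀ * f ^ 2)) G = (t : 𝔽) * ι x := by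
  intro n₀ f K _ _ εK hsq h4 hf hcut hK hdisc hεK
  obtain ⟨y, hy, hGy⟩ := hG _ hcut
  obtain ⟨-, -, hJ, -, -, -⟩ := hcut
  have hdiv : m * (n₀ * f ^ 2) / m = n₀ * f ^ 2 := Nat.mul_div_cancel_left _ (Nat.pos_of_ne_zero (NeZero.ne m))
  rw [hdiv] at hJ
  obtain ⟨t, x, ht1, hx, hH⟩ := exists_dictionary_cut hp4 h7 hmp hχ hχq hk hpar hsq h4 hf hJ hK hdisc hεK
  refine ⟨t, x, ht1, hx, ?_⟩
  have hyx : y = -((t : ℤ_[p]) * x) := by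
    apply PadicInt.ext
    rw [hy, hH, PadicInt.coe_neg, PadicInt.coe_mul, PadicInt.coe_intCast]
  rw [hGy, hyx, neg_neg, map_mul, map_intCast]

/-! ## §3 `G := −Y.map ι` satisfies the SUPPORT and DICTIONARY conjuncts of `stub_cutForm` -/

/-- **THE CANONICAL `G` OF (CutForm⁶): support and dictionary conjuncts, VERBATIM.** For the class datum (`p ≡ 3 (mod 4)`, `p ≥ 7`,
`p ∤ m`, `χ` primitive quadratic mod `m`, `k ∈ {(p+1)/4, (3p−1)/4}`, parity clause) and auxiliary `(r, e)` there is a `ℤ_p`-integral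
series `Y` (the cut Cohen series, §1) such that for EVERY field `𝔽` and EVERY ring map `ι : ℤ_[p] →+* 𝔽`, the series
`G := −(PowerSeries.map ι Y)` satisfies the two `G`-only conjuncts of registry v23/v24's `stub_cutForm`:
`∀ a, coeff a G ≠ 0 → a ∈ CUT(m, r, e)` and the dictionary clause `∀ n₀ f K ε_K, … → ∃ t x, (f = 1 → t = 1) ∧ ↑x = k⁻¹B_k((χ↑ε_K↑)~) ∧
coeff (m n₀ f²) G = t · ι x`. (The remaining conjuncts — the Katz family containing `G·T` — are the typing facts NF-A/B/C/D.)
[cite: Cohen1975, §2 (definition of H(r, N))] -/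
theorem cutForm_support_and_dictionary {m : ℕ} [NeZero m] {χ : DirichletCharacter ℚ_[p] m} {k : ℕ}
    (hp4 : p % 4 = 3) (h7 : 7 ≤ p) (hmp : m.Coprime p) (hχ : χ.IsPrimitive) (hχq : χ.IsQuadratic)
    (hk : k = (p + 1) / 4 ∨ k = (3 * p - 1) / 4) (hpar : χ (-1) * (-1) ^ k = -1) (r e : ℕ) :
    ∃ Y : PowerSeries ℤ_[p],
      (∀ a : ℕ, (m ∣ a ∧ a / m % 4 = 3 ∧ (∀ q : ℕ, q.Prime → q ∣ m → q ≠ 2 → jacobiSym (-((a / m : ℕ) : ℤ)) q = 1) ∧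
          (2 ∣ m → a / m % 8 = 7) ∧ r ^ e ∣ a / m ∧ ¬ r ^ (e + 1) ∣ a / m) →
        ((coeff a Y : ℤ_[p]) : ℚ_[p]) = ((cohenH k a : ℚ) : ℚ_[p])) ∧
      ∀ (𝔽 : Type) [Field 𝔽] (ι : ℤ_[p] →+* 𝔽),
        (∀ a : ℕ, coeff a (-(PowerSeries.map ι Y)) ≠ 0 →
          m ∣ a ∧ a / m % 4 = 3 ∧ (∀ q : ℕ, q.Prime → q ∣ m → q ≠ 2 → jacobiSym (-((a / m : ℕ) : ℤ)) q = 1) ∧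
            (2 ∣ m → a / m % 8 = 7) ∧ r ^ e ∣ a / m ∧ ¬ r ^ (e + 1) ∣ a / m) ∧
        (∀ (n₀ f : ℕ) (K : Type) [Field K] [NumberField K] (εK : DirichletCharacter ℚ_[p] (NumberField.discr K).natAbs),
          Squarefree n₀ → n₀ % 4 = 3 → 0 < f →
          (m ∣ m * (n₀ * f ^ 2) ∧ m * (n₀ * f ^ 2) / m % 4 = 3 ∧
            (∀ q : ℕ, q.Prime → q ∣ m → q ≠ 2 → jacobiSym (-((m * (n₀ * f ^ 2) / m : ℕ) : ℤ)) q = 1) ∧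
            (2 ∣ m → m * (n₀ * f ^ 2) / m % 8 = 7) ∧ r ^ e ∣ m * (n₀ * f ^ 2) / m ∧
            ¬ r ^ (e + 1) ∣ m * (n₀ * f ^ 2) / m) →
          IsImaginaryQuadratic K → NumberField.discr K = -(n₀ : ℤ) → IsKroneckerCharacterOf K εK →
          ∃ (t : ℤ) (x : ℤ_[p]), (f = 1 → t = 1) ∧
            (x : ℚ_[p]) = (k : ℚ_[p])⁻¹ * @generalizedBernoulli ℚ_[p] _ _
              (changeLevel (dvd_mul_right m (NumberField.discr K).natAbs) χ *
                changeLevel (dvd_mul_left (NumberField.discr K).natAbs m) εK).conductor ⟨conductor_ne_zero _⟩ k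
              (changeLevel (dvd_mul_right m (NumberField.discr K).natAbs) χ *
                changeLevel (dvd_mul_left (NumberField.discr K).natAbs m) εK).primitiveCharacter ∧
            coeff (m * (n₀ * f ^ 2)) (-(PowerSeries.map ι Y)) = (t : 𝔽) * ι x) := by
  obtain ⟨Y, hY, hY0⟩ := exists_cutSeries hp4 h7 hmp hχ hχq hk hpar r e
  refine ⟨Y, hY, fun 𝔽 _ ι => ⟨fun a ha => ?_, ?_⟩⟩
  · -- support: off the cut the coefficient of `Y` vanishes
    by_contra hcut
    exact ha (by rw [map_neg, coeff_map, hY0 a hcut, map_zero, neg_zero])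
  · -- dictionary: §2 with `y_a := coeff a Y` on the refined cut
    exact cutForm_dictionary_of_coeff_cut hp4 h7 hmp hχ hχq hk hpar ι (-(PowerSeries.map ι Y)) fun a hcut =>
      ⟨coeff a Y, hY a hcut, by rw [map_neg, coeff_map, map_neg]⟩

end Summit.BirchSwinnertonDyer.BirchSwinnertonDyer.Theorems.PrintCFram.CohenCut

end
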